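import Summits.KontsevichZagierPeriods.KontsevichZagierPeriods.Theorems.MultiplicationAccessible.Negative.Core
import Literature.NumberTheory.Transcendental.KZProductIdeal
import Literature.NumberTheory.Transcendental.KZSubcalculusInvariants
import Literature.NumberTheory.Transcendental.KZMellinFibres

/-!
# `MultiplicationAccessible` (stmt-KontsevichZagierPeriods-12305, route TerasomaMultiplication) —
line `shifted-family-prime-sieve`, stub `stub_dupSymmetrise`

Legendre duplication in shifted form, first half, as a chain of Kontsevich–Zagier moves
[Kontsevich–Zagier 2001, §1.2 rules (1b) and (2)]: a box representation
`r = [(0,1)², η₀^{x−1}(1−η₀)^{s−1} · η₁^{x−1/2}(1−η₁)^{s−1}]` of `B(x,s)B(x+½,s)` is equivalent to the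
SYMMETRISED Kummer pull-back `q = [(0,1)², 2(η₀η₁)^{2x−1}(η₀+η₁)((1−η₀²)(1−η₁²))^{s−1}]`, which is
constructed here. The chain:

* `r` is the box-Mellin member of the family `(X₀, 1 − X₀, X₁, 1 − X₁)` with exponents
  `(x−1, s−1, x−1/2, s−1)`; dilating both coordinates (`ξᵢ = ηᵢ²`, the Kummer coverings
  `KZ.IsMellinMemberWith.of_sub_of_mem_relations_dilate`, absolute convergence transported by
  `KZ.integrableOn_mellinIntegrand_dilateData_iff`) gives a member `G = [(0,1)², g]`,
  `g = 4 η₀^{2x−1} η₁^{2x} ((1−η₀²)(1−η₁²))^{s−1}`, with `[G] − [r] ∈ relations`;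
* the swap `G' = G.reindex (swap 0 1)` is a move (`KZ.of_sub_of_reindex_mem_relations`);
* `g + g ∘ swap = 2 · (2(η₀η₁)^{2x−1}(η₀+η₁)((1−η₀²)(1−η₁²))^{s−1})` on the box, so with
  `q = [(0,1)², ½(g + g∘swap)]` (integrable as a sum) integrand additivity gives
  `[2q] − [G] − [G']` and `[2q] − 2•[q]` in `relations`, hence `2 • ([G] − [q]) ∈ relations`;
* torsion-freeness of `FormalRep ⧸ relations`
  (`Negative.mem_relations_of_nsmul_mem_relations`) removes the factor `2`.

No definitions are introduced (pure proof file); the auxiliary representations are built with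
`KZ.IntegralRep.ofMellin` and an anonymous constructor.

References: M. Kontsevich, D. Zagier, *Periods* (2001), §1.2; G. Andrews, R. Askey, R. Roy,
*Special Functions* (1999), Thm 1.5.1 (Legendre duplication).
-/

noncomputable section

open MeasureTheory Set
open Literature.NumberTheory.Transcendental
open Literature.NumberTheory.Transcendental.KZ
open Literature.ModelTheory.ExponentialFields (IsSemialgebraic)
open MvPolynomial (X C aeval)
open Summit.KontsevichZagierPeriods.MultiplicationAccessible.Negative
  (mem_relations_of_nsmul_mem_relations)

namespace Summit.KontsevichZagierPeriods.TerasomaMultiplication.MultiplicationAccessible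

namespace DupSymmetrise

/-! ## Pointwise identities -/

/-- The Kummer pull-back algebra: `(u²)^{a−1}(1−u²)^{b−1}·((v²)^{a−1/2}(1−v²)^{b−1})·2u·2v
= 4 u^{2a−1} v^{2a} ((1−u²)(1−v²))^{b−1}` for `0 < u, v < 1`. [folklore] -/
theorem kummer_algebra (a b : ℝ) {u v : ℝ} (hu : 0 < u) (hv : 0 < v) (hu1 : u < 1) (hv1 : v < 1) :
    (u ^ 2) ^ (a - 1) * (1 - u ^ 2) ^ (b - 1) * ((v ^ 2) ^ (a - 1 / 2) * (1 - v ^ 2) ^ (b - 1)) *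
        (2 * u) * (2 * v) =
      4 * u ^ (2 * a - 1) * v ^ (2 * a) * ((1 - u ^ 2) * (1 - v ^ 2)) ^ (b - 1) := by
  have e1 : (u ^ 2) ^ (a - 1) * u = u ^ (2 * a - 1) := by
    rw [← Real.rpow_natCast u 2, ← Real.rpow_mul hu.le, ← Real.rpow_add_one hu.ne']
    congr 1
    push_cast
    ring
  have e2 : (v ^ 2) ^ (a - 1 / 2) * v = v ^ (2 * a) := by
    rw [← Real.rpow_natCast v 2, ← Real.rpow_mul hv.le, ← Real.rpow_add_one hv.ne']
    congr 1
    push_cast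
    ring
  have hu2 : 0 < 1 - u ^ 2 := by nlinarith
  have hv2 : 0 < 1 - v ^ 2 := by nlinarith
  rw [Real.mul_rpow hu2.le hv2.le, ← e1, ← e2]
  ring

/-- The symmetrisation algebra: `g(u,v) + g(v,u) = 2 · (2(uv)^{2a−1}(u+v)((1−u²)(1−v²))^{b−1})`
for `g(u,v) = 4 u^{2a−1} v^{2a} ((1−u²)(1−v²))^{b−1}`, `0 < u, v`. [folklore] -/
theorem symmetrise_algebra (a b : ℝ) {u v : ℝ} (hu : 0 < u) (hv : 0 < v) :
    4 * u ^ (2 * a - 1) * v ^ (2 * a) * ((1 - u ^ 2) * (1 - v ^ 2)) ^ (b - 1) +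
        4 * v ^ (2 * a - 1) * u ^ (2 * a) * ((1 - v ^ 2) * (1 - u ^ 2)) ^ (b - 1) =
      2 * (2 * (u * v) ^ (2 * a - 1) * (u + v) * ((1 - u ^ 2) * (1 - v ^ 2)) ^ (b - 1)) := by
  have e1 : u ^ (2 * a) = u ^ (2 * a - 1) * u := by
    rw [← Real.rpow_add_one hu.ne']
    congr 1
    ring
  have e2 : v ^ (2 * a) = v ^ (2 * a - 1) * v := by
    rw [← Real.rpow_add_one hv.ne']
    congr 1
    ring
  rw [e1, e2, Real.mul_rpow hu.le hv.le, mul_comm (1 - v ^ 2) (1 - u ^ 2)]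
  ring

/-! ## The Mellin data -/

/-- The given box integrand is the Euler–Mellin integrand of the family `(X₀, 1 − X₀, X₁, 1 − X₁)`
with exponents `(x−1, s−1, x−1/2, s−1)` and constant `1`. [folklore] -/
theorem mellinIntegrand_beta2 (x s : ℚ) (z : Fin 2 → ℝ) :
    mellinIntegrand ![(X 0 : MvPolynomial (Fin 2) ℚ), 1 - X 0, X 1, 1 - X 1]
        ![x - 1, s - 1, x - 1 / 2, s - 1] 1 z =
      (z 0) ^ ((x:ℝ) - 1) * (1 - z 0) ^ ((s:ℝ) - 1) *
        ((z 1) ^ ((x:ℝ) - 1 / 2) * (1 - z 1) ^ ((s:ℝ) - 1)) := by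
  simp only [mellinIntegrand_apply, Fin.prod_univ_four, Matrix.cons_val_zero, Matrix.cons_val_one,
    Matrix.cons_val, MvPolynomial.aeval_X, map_sub, map_one]
  push_cast
  ring

/-- On the open box all four members of the family `(X₀, 1 − X₀, X₁, 1 − X₁)` are positive: the
box is contained in (hence equal to) the Mellin box of the family. [folklore] -/
theorem box_subset_mellinBox_beta2 :
    {z : Fin 2 → ℝ | ∀ i, z i ∈ Set.Ioo (0:ℝ) 1} ⊆
      mellinBox ![(X 0 : MvPolynomial (Fin 2) ℚ), 1 - X 0, X 1, 1 - X 1] := by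
  intro z hz
  refine ⟨hz, fun k => ?_⟩
  have h0 := hz 0
  have h1 := hz 1
  fin_cases k
  · simpa using h0.1
  · simpa using h0.2
  · simpa using h1.1
  · simpa using h1.2

/-- The symmetrised integrand is the Euler–Mellin integrand of the family
`(X₀X₁, X₀ + X₁, (1 − X₀²)(1 − X₁²))` with exponents `(2x−1, 1, s−1)` and constant `2`. [folklore] -/
theorem mellinIntegrand_symm (x s : ℚ) (z : Fin 2 → ℝ) :
    mellinIntegrand ![(X 0 * X 1 : MvPolynomial (Fin 2) ℚ), X 0 + X 1, (1 - X 0 ^ 2) * (1 - X 1 ^ 2)]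
        ![2 * x - 1, 1, s - 1] 2 z =
      2 * (z 0 * z 1) ^ (2 * (x:ℝ) - 1) * (z 0 + z 1) *
        ((1 - z 0 ^ 2) * (1 - z 1 ^ 2)) ^ ((s:ℝ) - 1) := by
  simp only [mellinIntegrand_apply, Fin.prod_univ_three, Matrix.cons_val_zero, Matrix.cons_val_one,
    Matrix.cons_val, MvPolynomial.aeval_X, map_sub, map_one, map_mul, map_add, map_pow]
  push_cast
  rw [Real.rpow_one]
  ring

/-- On the open box the three members of the family `(X₀X₁, X₀ + X₁, (1 − X₀²)(1 − X₁²))` are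
positive. [folklore] -/
theorem aeval_symm_pos {z : Fin 2 → ℝ} (hz : z ∈ {z : Fin 2 → ℝ | ∀ i, z i ∈ Set.Ioo (0:ℝ) 1})
    (k : Fin 3) :
    0 < aeval z (![(X 0 * X 1 : MvPolynomial (Fin 2) ℚ), X 0 + X 1, (1 - X 0 ^ 2) * (1 - X 1 ^ 2)] k) := by
  have h0 := hz 0
  have h1 := hz 1
  have hu2 : 0 < 1 - z 0 ^ 2 := by nlinarith [h0.1, h0.2]
  have hv2 : 0 < 1 - z 1 ^ 2 := by nlinarith [h1.1, h1.2]
  fin_cases k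
  · simpa using mul_pos h0.1 h1.1
  · simpa using add_pos h0.1 h1.1
  · simpa using mul_pos hu2 hv2

/-! ## The moves -/

/-- A box dilation of a family whose Mellin box is the whole open box again has the whole open box
as Mellin box. [cite: KontsevichZagier2001, §1.2 rule (2)] -/
theorem box_subset_mellinBox_dilateData {m K : ℕ} (j : Fin m) (k : ℕ)
    (g : Fin K → MvPolynomial (Fin m) ℚ)
    (hg : {z : Fin m → ℝ | ∀ i, z i ∈ Set.Ioo (0:ℝ) 1} ⊆ mellinBox g) :
    {z : Fin m → ℝ | ∀ i, z i ∈ Set.Ioo (0:ℝ) 1} ⊆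
      mellinBox (Fin.append (dilateFamily j k g) (fun _ : Fin 1 => (X j : MvPolynomial (Fin m) ℚ))) := by
  intro z hz
  rw [mellinBox_dilateData, mellinBox_dilateFamily]
  exact ⟨hz, hg (boxDilation_mem_box hz)⟩

/-- **Two Kummer coverings.** A box-Mellin member `r` on the whole open box `(0,1)²` is congruent
modulo relations to a representation `G` on the open box whose integrand is the pull-back of the
Euler–Mellin integrand along `ξ₀ = η₀²`, `ξ₁ = η₁²`, Jacobians `2η₀ · 2η₁` included (two moves
`KZ.IsMellinMemberWith.of_sub_of_mem_relations_dilate`; absolute convergence is transported).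
[cite: KontsevichZagier2001, §1.2 rule (2)] -/
theorem exists_dilate_two {K : ℕ} {g : Fin K → MvPolynomial (Fin 2) ℚ} {e : Fin K → ℚ} {κ : ℚ}
    {r : IntegralRep 2} (hr : IsMellinMemberWith g e κ r)
    (hg : {z : Fin 2 → ℝ | ∀ i, z i ∈ Set.Ioo (0:ℝ) 1} ⊆ mellinBox g) :
    ∃ G : IntegralRep 2, G.domain = {z : Fin 2 → ℝ | ∀ i, z i ∈ Set.Ioo (0:ℝ) 1} ∧
      (∀ z ∈ {z : Fin 2 → ℝ | ∀ i, z i ∈ Set.Ioo (0:ℝ) 1}, G.integrand z =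
        mellinIntegrand g e κ (boxDilation 0 1 (boxDilation 1 1 z)) *
          ((1 + 1 : ℕ) * (boxDilation 1 1 z) 0 ^ 1) * ((1 + 1 : ℕ) * z 1 ^ 1)) ∧
      of G - of r ∈ relations := by
  have hint0 := (exists_isMellinMemberWith_iff g e κ).1 ⟨r, hr⟩
  have hint1 := (integrableOn_mellinIntegrand_dilateData_iff 0 1 g e κ).2 hint0
  have hG1 := isMellinMemberWith_ofMellin _ _ _ hint1
  have hint2 := (integrableOn_mellinIntegrand_dilateData_iff 1 1 _ _ _).2 hint1
  have hG2 := isMellinMemberWith_ofMellin _ _ _ hint2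
  refine ⟨IntegralRep.ofMellin _ _ _ hint2, ?_, fun z _ => ?_, ?_⟩
  · exact (mellinBox_subset_box _).antisymm
      (box_subset_mellinBox_dilateData 1 1 _ (box_subset_mellinBox_dilateData 0 1 g hg))
  · rw [IntegralRep.ofMellin_integrand, mellinIntegrand_dilateData, mellinIntegrand_dilateData]
  · have h := relations.add_mem (hG2.of_sub_of_mem_relations_dilate hG1)
      (hG1.of_sub_of_mem_relations_dilate hr)
    rwa [sub_add_sub_cancel] at h

/-- **Symmetrisation under the swap.** If `G = [(0,1)², g]` and `g + g∘swap = 2F` on the box with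
`F` a `ℚ`-semialgebraic function, then `q = [(0,1)², F]` is an integral representation (absolutely
convergent as half a sum of two convergent integrals) and `[G] − [q] ∈ relations`: the swap is a
move (`KZ.of_sub_of_reindex_mem_relations`), `[2q] − [G] − [G∘swap]` and `[2q] − 2•[q]` are
integrand additivity, and `FormalRep ⧸ relations` is torsion-free
(`Negative.mem_relations_of_nsmul_mem_relations`). [cite: KontsevichZagier2001, §1.2 rule (1)] -/
theorem exists_symmetrise {G : IntegralRep 2}
    (hGd : G.domain = {z : Fin 2 → ℝ | ∀ i, z i ∈ Set.Ioo (0:ℝ) 1}) {F : (Fin 2 → ℝ) → ℝ}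
    (hF : IsSemialgebraicFunOn ℚ {z : Fin 2 → ℝ | ∀ i, z i ∈ Set.Ioo (0:ℝ) 1} F)
    (hsum : ∀ z ∈ {z : Fin 2 → ℝ | ∀ i, z i ∈ Set.Ioo (0:ℝ) 1},
      G.integrand z + G.integrand (fun i => z (Equiv.swap (0 : Fin 2) 1 i)) = 2 * F z) :
    ∃ q : IntegralRep 2, q.domain = {z : Fin 2 → ℝ | ∀ i, z i ∈ Set.Ioo (0:ℝ) 1} ∧
      q.integrand = F ∧ of G - of q ∈ relations := by
  have hmeas : MeasurableSet {z : Fin 2 → ℝ | ∀ i, z i ∈ Set.Ioo (0:ℝ) 1} :=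
    (isSemialgebraic_box 2).measurableSet_holds
  -- the swapped representation
  have hG'd : (G.reindex (Equiv.swap (0 : Fin 2) 1)).domain =
      {z : Fin 2 → ℝ | ∀ i, z i ∈ Set.Ioo (0:ℝ) 1} := by
    ext w
    simp only [IntegralRep.reindex_domain, hGd, mem_setOf_eq, Fin.forall_fin_two,
      Equiv.swap_apply_left, Equiv.swap_apply_right]
    exact and_comm
  have e_swap : of G - of (G.reindex (Equiv.swap (0 : Fin 2) 1)) ∈ relations :=
    of_sub_of_reindex_mem_relations G _
  -- absolute convergence of `F = (g + g∘swap)/2`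
  have hGi : IntegrableOn G.integrand {z : Fin 2 → ℝ | ∀ i, z i ∈ Set.Ioo (0:ℝ) 1} :=
    hGd ▸ G.integrableOn
  have hG'i : IntegrableOn (G.reindex (Equiv.swap (0 : Fin 2) 1)).integrand
      {z : Fin 2 → ℝ | ∀ i, z i ∈ Set.Ioo (0:ℝ) 1} :=
    hG'd ▸ (G.reindex (Equiv.swap (0 : Fin 2) 1)).integrableOn
  have hFi : IntegrableOn F {z : Fin 2 → ℝ | ∀ i, z i ∈ Set.Ioo (0:ℝ) 1} := by
    have h : IntegrableOn (fun z => (2⁻¹ : ℝ) *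
        ((G.integrand + (G.reindex (Equiv.swap (0 : Fin 2) 1)).integrand) z))
        {z : Fin 2 → ℝ | ∀ i, z i ∈ Set.Ioo (0:ℝ) 1} :=
      (hGi.add hG'i).const_mul (2⁻¹ : ℝ)
    refine h.congr_fun (fun z hz => ?_) hmeas
    simp only [Pi.add_apply, IntegralRep.reindex_integrand]
    rw [hsum z hz]
    ring
  -- the symmetrised representation `q` and its double `R = [box, 2F]`
  let q : IntegralRep 2 := ⟨_, F, isSemialgebraic_box 2, hF, hFi⟩
  have e_R : of (q.constMul ((2 : ℕ) : ℝ) (isAlgebraic_nat 2)) - 2 • of q ∈ relations :=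
    IntegralRep.of_constMul_nat_sub_nsmul_mem_relations q 2
  have e_add : of (q.constMul ((2 : ℕ) : ℝ) (isAlgebraic_nat 2)) - of G -
      of (G.reindex (Equiv.swap (0 : Fin 2) 1)) ∈ relations := by
    refine integrandAddRel_subset_relations
      ⟨2, _, G, G.reindex (Equiv.swap (0 : Fin 2) 1), hGd, hG'd, fun z hz => ?_, rfl⟩
    have hz' : z ∈ {z : Fin 2 → ℝ | ∀ i, z i ∈ Set.Ioo (0:ℝ) 1} := hz
    simp only [IntegralRep.integrand_constMul, Pi.add_apply, IntegralRep.reindex_integrand]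
    rw [hsum z hz']
    push_cast
    rfl
  -- bookkeeping and torsion-freeness
  have h2 : (2 : ℕ) • (of G - of q) ∈ relations := by
    have key : (2 : ℕ) • (of G - of q) =
        (of (q.constMul ((2 : ℕ) : ℝ) (isAlgebraic_nat 2)) - 2 • of q) -
        (of (q.constMul ((2 : ℕ) : ℝ) (isAlgebraic_nat 2)) - of G -
          of (G.reindex (Equiv.swap (0 : Fin 2) 1))) +
        (of G - of (G.reindex (Equiv.swap (0 : Fin 2) 1))) := by
      simp only [two_nsmul]
      abel
    rw [key]
    exact relations.add_mem (relations.sub_mem e_R e_add) e_swap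
  exact ⟨q, rfl, rfl, mem_relations_of_nsmul_mem_relations two_ne_zero h2⟩

/-- **The pulled-back integrand in closed form**: on the open box,
`f(η₀², η₁²) · 2η₀ · 2η₁ = 4 η₀^{2x−1} η₁^{2x} ((1−η₀²)(1−η₁²))^{s−1}` for the Euler–Mellin integrand
`f = ξ₀^{x−1}(1−ξ₀)^{s−1} ξ₁^{x−1/2}(1−ξ₁)^{s−1}`. [folklore] -/
theorem pullback_eq (x s : ℚ) {z : Fin 2 → ℝ}
    (hz : z ∈ {z : Fin 2 → ℝ | ∀ i, z i ∈ Set.Ioo (0:ℝ) 1}) :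
    mellinIntegrand ![(X 0 : MvPolynomial (Fin 2) ℚ), 1 - X 0, X 1, 1 - X 1]
        ![x - 1, s - 1, x - 1 / 2, s - 1] 1 (boxDilation 0 1 (boxDilation 1 1 z)) *
        ((1 + 1 : ℕ) * (boxDilation 1 1 z) 0 ^ 1) * ((1 + 1 : ℕ) * z 1 ^ 1) =
      4 * (z 0) ^ (2 * (x:ℝ) - 1) * (z 1) ^ (2 * (x:ℝ)) *
        ((1 - z 0 ^ 2) * (1 - z 1 ^ 2)) ^ ((s:ℝ) - 1) := by
  have h10 : (1 : Fin 2) ≠ 0 := by decide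
  have h01 : (0 : Fin 2) ≠ 1 := by decide
  rw [mellinIntegrand_beta2]
  simp only [boxDilation_apply_self, boxDilation_apply_of_ne 1 h10, boxDilation_apply_of_ne 1 h01,
    Nat.reduceAdd, Nat.cast_ofNat, pow_one]
  exact kummer_algebra (x:ℝ) (s:ℝ) (hz 0).1 (hz 1).1 (hz 0).2 (hz 1).2

end DupSymmetrise

open DupSymmetrise in
/-- **Duplication, first half** (stub `stub_dupSymmetrise` of the line `shifted-family-prime-sieve`):
two Kummer dilations `ξᵢ = ηᵢ²` (`KZ.of_sub_of_mem_relations_of_boxDilation`, through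
`KZ.IsMellinMemberWith.of_sub_of_mem_relations_dilate`), the swap `η₀ ↔ η₁`
(`KZ.of_sub_of_reindex_mem_relations`), integrand additivity and torsion-freeness
(`Negative.mem_relations_of_nsmul_mem_relations`) turn the box representation of
`B(x,s)B(x+½,s)` into the SYMMETRISED Kummer pull-back
`[(0,1)², 2(η₀η₁)^{2x−1}(η₀+η₁)((1−η₀²)(1−η₁²))^{s−1}]`, which exists.
[cite: KontsevichZagier2001, §1.2] -/
theorem stub_dupSymmetrise :
    ∀ (x s : ℚ), 0 < x → 0 < s → ∀ (r : KZ.IntegralRep 2),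
      r.domain = {z | ∀ i, z i ∈ Set.Ioo (0:ℝ) 1} →
      Set.EqOn r.integrand (fun z => (z 0) ^ ((x:ℝ) - 1) * (1 - z 0) ^ ((s:ℝ) - 1) *
        ((z 1) ^ ((x:ℝ) - 1/2) * (1 - z 1) ^ ((s:ℝ) - 1))) r.domain →
      ∃ q : KZ.IntegralRep 2, q.domain = {z | ∀ i, z i ∈ Set.Ioo (0:ℝ) 1} ∧
        Set.EqOn q.integrand (fun z => 2 * (z 0 * z 1) ^ (2 * (x:ℝ) - 1) * (z 0 + z 1) *
          ((1 - z 0 ^ 2) * (1 - z 1 ^ 2)) ^ ((s:ℝ) - 1)) q.domain ∧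
        KZ.Equivalent r q := by
  intro x s _ _ r hr hri
  -- `r` is the box-Mellin member of `(X₀, 1 − X₀, X₁, 1 − X₁)`, exponents `(x−1, s−1, x−1/2, s−1)`
  have hr_mem : IsMellinMemberWith ![(X 0 : MvPolynomial (Fin 2) ℚ), 1 - X 0, X 1, 1 - X 1]
      ![x - 1, s - 1, x - 1 / 2, s - 1] 1 r := by
    refine ⟨hr.trans ((mellinBox_subset_box _).antisymm box_subset_mellinBox_beta2).symm,
      fun z hz => ?_⟩
    rw [hri hz, mellinIntegrand_beta2]
  -- two Kummer coverings
  obtain ⟨G, hGd, hGi, eG⟩ := exists_dilate_two hr_mem box_subset_mellinBox_beta2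
  -- the symmetrised integrand
  have hF : IsSemialgebraicFunOn ℚ {z : Fin 2 → ℝ | ∀ i, z i ∈ Set.Ioo (0:ℝ) 1}
      (fun z => 2 * (z 0 * z 1) ^ (2 * (x:ℝ) - 1) * (z 0 + z 1) *
        ((1 - z 0 ^ 2) * (1 - z 1 ^ 2)) ^ ((s:ℝ) - 1)) :=
    (isSemialgebraicFunOn_mellinIntegrand (isSemialgebraic_box 2) _ _ 2
      (fun _ hz k => aeval_symm_pos hz k)).congr fun z _ => mellinIntegrand_symm x s z
  have hsum : ∀ z ∈ {z : Fin 2 → ℝ | ∀ i, z i ∈ Set.Ioo (0:ℝ) 1},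
      G.integrand z + G.integrand (fun i => z (Equiv.swap (0 : Fin 2) 1 i)) =
        2 * (2 * (z 0 * z 1) ^ (2 * (x:ℝ) - 1) * (z 0 + z 1) *
          ((1 - z 0 ^ 2) * (1 - z 1 ^ 2)) ^ ((s:ℝ) - 1)) := by
    intro z hz
    have hz' : (fun i => z (Equiv.swap (0 : Fin 2) 1 i)) ∈
        {z : Fin 2 → ℝ | ∀ i, z i ∈ Set.Ioo (0:ℝ) 1} := fun i => hz _
    rw [hGi z hz, hGi _ hz', pullback_eq x s hz, pullback_eq x s hz']
    simp only [Equiv.swap_apply_left, Equiv.swap_apply_right]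
    exact symmetrise_algebra (x:ℝ) (s:ℝ) (hz 0).1 (hz 1).1
  obtain ⟨q, hqd, hqi, eGq⟩ := exists_symmetrise hGd hF hsum
  refine ⟨q, hqd, fun z _ => by rw [hqi], ?_⟩
  change of r - of q ∈ relations
  have key : of r - of q = (of G - of q) - (of G - of r) := by abel
  rw [key]
  exact relations.sub_mem eGq eG

end Summit.KontsevichZagierPeriods.TerasomaMultiplication.MultiplicationAccessible
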